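import Mathlib
import HarnessLib
import Literature.MathematicalPhysics.QuantumFieldTheory.UniformTorusClusteringProofs
import Summits.QuantumFields.YangMills.Theses.PencilRigidity
import Summits.QuantumFields.YangMills.Theorems.PencilRigidityCurvatureKernelBoundLatticeWindowTransferLemmas
import Summits.QuantumFields.YangMills.Theorems.PencilRigidityCurvatureKernelBoundTwoPointLocalBoundSemiDegenerate
import Summits.QuantumFields.YangMills.Theorems.PencilRigidityCurvatureKernelBoundKernelConclusionOfWitnessLocalDecay
import Summits.QuantumFields.YangMills.Theorems.InfraredLiouvilleStrongCouplingIRTrivial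
import Summits.QuantumFields.YangMills.Theorems.PencilRigidityCurvatureKernelBoundStrongCouplingClusteringDisc
import Summits.QuantumFields.YangMills.Theorems.PencilRigidityCurvatureKernelBoundStrongCouplingTruncatedVanishing

/-!
# `CurvatureKernelBound` — child `FiniteCoupling` on the strong-coupling disc, for sub-exponentially renormalised schemes
# (support for stmt-QuantumFields-11687, line `coupling-trichotomy`)

Crux `stmt-QuantumFields-11687` (`PencilRigidity.CurvatureKernelBound`), line `coupling-trichotomy` (the strategist's split by
coupling regime: `CurvatureKernelBoundWeakCoupling → …FiniteCoupling → …NegativeCoupling → CurvatureKernelBound`, glue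
`CurvatureKernelBound_of_subs` p137385). This file is the SUPPORT for the child `Stub.FiniteCoupling` (`β_k → b ∈ ℝ`) on the
strong-coupling disc `|b| < β₁(G, r)`: there every `W₁`-datum whose plaquette renormalisation is sub-exponential in the inverse
spacing (`c_k² e^{−δ/a_k} → 0` for all `δ > 0` — every polynomial `c_k`, in particular the canonical `c_k ≍ a_k⁻⁴`) satisfies
the conclusion of the crux, UNCONDITIONALLY: the Osterwalder–Seiler strong-coupling cluster expansion is a proved tree
theorem (`osterwalder_seiler_torusClustering_uniform_holds`; β-uniform disc form `StrongCouplingClusteringDisc`, p137906).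

Proof (`FiniteCouplingStrongSubexp`): with `β' = (|b| + β₁)/2` the couplings eventually lie in the closed disc `|β| ≤ β'`;
`StrongCouplingClusteringDisc` gives one mass and one constant for the curvature there; `StrongCouplingTruncatedVanishing`
(p138330) makes the truncated smeared lattice two-point function vanish in the limit on the separated axial balls
`B̄(∓s e₀, ρ)`, `ρ ≤ s/2`; the lattice tie of `W₁` at `n = 2, 1` then gives `S₁ 2 (f 0 ⊗ f 1) = S₁ 1 f 0 · S₁ 1 f 1 = κ² ∫f 0 ∫f 1`
(`S₁ 1 = κ∫` by translation invariance), i.e. the two-point LOCAL DECAY with `η = 10`, `A = ‖κ‖²`, `B = 0`; and the landed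
`KernelConclusionOfWitnessLocalDecay` (p131920) turns local decay into the real kernel continuous off `0`, bounded by
`C (1 + ‖x‖^(η−10))`, representing `S₁ 2` on `⁰𝒮`. What is NOT covered (and stays open inside `Stub.FiniteCoupling`): schemes in
the disc with `limsup a_k log c_k² > 0` (physically not `W₁`-inhabitants: the two-sided glueball asymptotics would make the
renormalised two-point function diverge — Schor 1983/84, not in the tree), and the intermediate couplings `β₁ ≤ |b|`
(lattice-gauge-theory phase structure). [folklore]
-/

noncomputable section

open scoped BigOperators Topology SchwartzMap
open MeasureTheory Filter Set Metric
open Literature.MathematicalPhysics.QuantumLattice Literature.MathematicalPhysics.AQFT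
  Literature.MathematicalPhysics.QuantumFieldTheory

namespace Summit.QuantumFields.YangMills.Theorems.CurvatureKernel

open SemiDegenerate BoundedRenormalisation in
/-- **Sub-goal C · `FiniteCouplingStrongSubexp`** (registered signature verbatim): the support for `Stub.FiniteCoupling` on
the strong-coupling disc. For every compact simple `G` and faithful `r` there is `β₁ = β₁(G, r) > 0` such that every
`W₁`-datum `(r, sch, S₁)` whose couplings converge INTO the disc (`β_k → b`, `|b| < β₁`) and whose plaquette renormalisation is
sub-exponential (`c_k² e^{−δ/a_k} → 0` for all `δ > 0`, e.g. every polynomial `c_k`) satisfies the conclusion of the crux: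
the truncated two-point function vanishes on separated axial balls (sub-goals A, B and the lattice tie of `W₁` at `n = 2, 1`),
so `S₁ 2 = κ² ∫⊗∫` there (two-point local decay with `η = 10`, `A = ‖κ‖²`, `B = 0`), and `KernelConclusionOfWitnessLocalDecay`
(p131920) turns the local decay into the real kernel continuous off `0` with `|K x| ≤ C (1 + ‖x‖^(η−10))` representing `S₁ 2`
on `⁰𝒮`. [folklore] -/
theorem FiniteCouplingStrongSubexp : open Literature.MathematicalPhysics.QuantumLattice Literature.MathematicalPhysics.AQFT Literature.MathematicalPhysics.QuantumFieldTheory in ∀ (G : Type) [Group G] [TopologicalSpace G] [IsTopologicalGroup G] [CompactSpace G] [MeasurableSpace G] [BorelSpace G], IsCompactSimpleLieGroup G → ∀ (r : LatticeRep G), ∃ β₁ : ℝ, 0 < β₁ ∧ ∀ (sch : SpeciesScheme (YMSpecies G)) (S₁ : SchwingerFamily (EuclideanSpace ℝ (Fin 4))), ((∀ (n : ℕ), n ≠ 0 → ∀ (f : Fin n → SchwartzMap ((EuclideanSpace ℝ (Fin 4))) ℝ) (F : SchwartzMap (Fin n → (EuclideanSpace ℝ (Fin 4))) ℂ), IsTensorOf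 F (fun i => ofRealTest (f i)) → IsOffDiagonal F → Filter.Tendsto (fun k : ℕ => ((latticeSchwinger r.ρ sch (fun s => s.F) k n (fun _ => r.curvature) f : ℝ) : ℂ)) Filter.atTop (nhds (S₁ n F))) ∧ (S₁.toLabelled.IsNormalized ∧ S₁.toLabelled.IsHermitian ∧ S₁.toLabelled.HasLinearGrowth ∧ S₁.toLabelled.IsReflectionPositive ∧ S₁.toLabelled.IsSymmetric ∧ S₁.toLabelled.HasClusterProperty) ∧ (∀ (n : ℕ) (a : (EuclideanSpace ℝ (Fin 4))) (F : SchwartzMap (Fin n → (EuclideanSpace ℝ (Fin 4))) ℂ), IsOffDiagonal F → S₁ n (translateMulti a F) = S₁ n F) ∧ (∀ (R : (EuclideanSpace ℝ (Fin 4)) ≃ₗᵢ[ℝ] (EuclideanSpace ℝ (Fin 4))), LinearMap.det (R.toLinearEquiv : (EuclideanSpace ℝ (Fin 4)) →ₗ[ℝ] (EuclideanSpace ℝ (Fin 4))) = 1 → (∀ i : Fin 4, ∃ j : Fin 4, R (EuclideanSpace.single i 1) = EuclideanSpace.single j 1 ∨ R (EuclideanSpace.single i 1) = -EuclideanSpace.single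 j 1) → ∀ (n : ℕ) (F : SchwartzMap (Fin n → (EuclideanSpace ℝ (Fin 4))) ℂ), IsOffDiagonal F → S₁ n (linActMulti R F) = S₁ n F) ∧ (∃ Δ : ℝ, 0 < Δ ∧ S₁.toLabelled.HasMassGap Δ ∧ HasLatticeMassGap r sch Δ)) → (∃ b : ℝ, Filter.Tendsto sch.β Filter.atTop (nhds b) ∧ |b| < β₁) → (∀ δ : ℝ, 0 < δ → Filter.Tendsto (fun k : ℕ => sch.c r.curvature k ^ 2 * Real.exp (-(δ / sch.a k))) Filter.atTop (nhds 0)) → ∃ (K : (EuclideanSpace ℝ (Fin 4)) → ℝ) (C η : ℝ), 0 < η ∧ ContinuousOn K {x : (EuclideanSpace ℝ (Fin 4)) | x ≠ 0} ∧ (∀ x : (EuclideanSpace ℝ (Fin 4)), x ≠ 0 → |K x| ≤ C * (1 + ‖x‖ ^ (η - 10))) ∧ ∀ F : SchwartzMap (Fin 2 → (EuclideanSpace ℝ (Fin 4))) ℂ, IsOffDiagonal F → MeasureTheory.Integrable (fun x : Fin 2 → (EuclideanSpace ℝ (Fin 4)) => (K (x 0 - x 1) : ℂ) * F x) ∧ S₁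 2 F = ∫ x : Fin 2 → (EuclideanSpace ℝ (Fin 4)), (K (x 0 - x 1) : ℂ) * F x := by
  intro G _ _ _ _ _ _ hG r
  haveI : T2Space G := (r.continuous.isClosedEmbedding r.injective).isEmbedding.t2Space
  haveI : SecondCountableTopology G :=
    (r.continuous.isClosedEmbedding r.injective).isEmbedding.secondCountableTopology
  obtain ⟨β₀, hβ₀, hA⟩ := StrongCouplingClusteringDisc 4 r.N G r.ρ (by norm_num) r.continuous
  refine ⟨β₀, hβ₀, ?_⟩
  rintro sch S₁ hW₁ ⟨b, hb, hbβ⟩ hc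
  -- the closed disc `|β| ≤ β'`, `|b| < β' < β₀`, eventually containing the couplings
  set β' : ℝ := (|b| + β₀) / 2 with hβ'def
  have hb0 : 0 ≤ |b| := abs_nonneg b
  have hβ'0 : 0 < β' := by rw [hβ'def]; linarith
  have hβ'1 : β' < β₀ := by rw [hβ'def]; linarith
  have hbβ' : |b| < β' := by rw [hβ'def]; linarith
  obtain ⟨m, hm, hAm⟩ := hA β' hβ'0 hβ'1
  obtain ⟨C, hC⟩ := hAm r.curvature.F r.curvature.F ⟨_, r.curvature.isCylinder⟩ ⟨_, r.curvature.isCylinder⟩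
    r.curvature.measurable r.curvature.measurable r.curvature.bounded r.curvature.bounded
  have hev : ∀ᶠ k in atTop, |sch.β k| ≤ β' :=
    ((continuous_abs.tendsto b).comp hb).eventually (Iic_mem_nhds hbβ')
  -- sub-goal B: the truncated lattice two-point function vanishes in the limit on separated axial balls
  have hB := StrongCouplingTruncatedVanishing G r sch β' m C hm hC hev hc
  -- the two-point LOCAL DECAY of `S₁` with `η = 10`, `A = ‖κ‖²`, `B = 0`
  obtain ⟨htie, -, htr, -, -⟩ := id hW₁
  obtain ⟨κ, hκ⟩ := exists_degreeOne_eq_const_mul_realIntegral S₁ htr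
  refine KernelConclusionOfWitnessLocalDecay G hG r sch S₁ hW₁ ⟨‖κ‖ ^ 2, 10, 1, by norm_num, one_pos, ?_⟩
  intro s hs _
  refine ⟨s / 2, ‖κ‖ ^ 2, 0, half_pos hs, sq_nonneg _, le_rfl, ?_, ?_⟩
  · rw [sub_self, Real.rpow_zero, mul_one, add_zero]
  · intro ρ hρ hρs f F M₀ M₁ hF h0 h1 hM₀ hM₁
    have hFoff : IsOffDiagonal F :=
      isOffDiagonal_of_isTensorOf_of_disjoint hF ((disjoint_closedBall_single hs hρs).mono h0 h1)
    obtain ⟨F₀, hF₀⟩ := exists_isTensorOf (n := 1) (fun _ : Fin 1 => ofRealTest (f 0))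
    obtain ⟨F₁, hF₁⟩ := exists_isTensorOf (n := 1) (fun _ : Fin 1 => ofRealTest (f 1))
    have hu := htie 2 two_ne_zero f F hF hFoff
    have hv := htie 1 one_ne_zero (fun _ => f 0) F₀ hF₀
      (HypercubicLimit.Negative.isOffDiagonal_fin_one F₀)
    have hw := htie 1 one_ne_zero (fun _ => f 1) F₁ hF₁
      (HypercubicLimit.Negative.isOffDiagonal_fin_one F₁)
    have ht := hB s ρ hs hρ hρs f M₀ M₁ h0 h1 hM₀ hM₁
    have ht' : Tendsto (fun k : ℕ =>
        ((latticeSchwinger r.ρ sch (fun s => s.F) k 2 (fun _ => r.curvature) f : ℝ) : ℂ) -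
          ((latticeSchwinger r.ρ sch (fun s => s.F) k 1 (fun _ => r.curvature) (fun _ => f 0) : ℝ) : ℂ) *
            ((latticeSchwinger r.ρ sch (fun s => s.F) k 1 (fun _ => r.curvature) (fun _ => f 1) : ℝ) : ℂ))
        atTop (𝓝 0) := by
      have h := (Complex.continuous_ofReal.tendsto 0).comp ht
      rw [Complex.ofReal_zero] at h
      refine h.congr fun k => ?_
      simp only [Function.comp_apply, Complex.ofReal_sub, Complex.ofReal_mul]
    have hZ : S₁ 2 F - S₁ 1 F₀ * S₁ 1 F₁ = 0 := tendsto_nhds_unique (hu.sub (hv.mul hw)) ht'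
    rw [hκ (f 0) F₀ hF₀, hκ (f 1) F₁ hF₁, sub_eq_zero] at hZ
    rw [hZ]
    calc ‖κ * ((∫ x : EuclideanSpace ℝ (Fin 4), f 0 x : ℝ) : ℂ) *
          (κ * ((∫ x : EuclideanSpace ℝ (Fin 4), f 1 x : ℝ) : ℂ))‖
        ≤ ‖κ‖ ^ 2 * (∫ x : EuclideanSpace ℝ (Fin 4), |f 0 x|) * (∫ x : EuclideanSpace ℝ (Fin 4), |f 1 x|) :=
          norm_disconnected_le κ f
      _ = ‖κ‖ ^ 2 * (∫ x : EuclideanSpace ℝ (Fin 4), |f 0 x|) * (∫ x : EuclideanSpace ℝ (Fin 4), |f 1 x|) +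
          0 * ρ ^ 8 * M₀ * M₁ := by ring

/-! ## Polynomial renormalisations are sub-exponential -/

/-- `x^q e^{−δx} → 0` as `x → +∞`, for `δ > 0`. [folklore] -/
theorem tendsto_pow_mul_exp_neg_mul {δ : ℝ} (hδ : 0 < δ) (q : ℕ) :
    Tendsto (fun x : ℝ => x ^ q * Real.exp (-(δ * x))) atTop (𝓝 0) := by
  have h := ((Real.tendsto_pow_mul_exp_neg_atTop_nhds_zero q).comp
    (tendsto_id.const_mul_atTop hδ)).const_mul ((δ ^ q)⁻¹)
  rw [mul_zero] at h
  refine h.congr fun x => ?_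
  simp only [Function.comp_apply, id, mul_pow]
  field_simp

/-- **Polynomially bounded renormalisations are sub-exponential in the inverse spacing**: if `|c_k| ≤ K₀ a_k^{−p}` and
`a_k → 0⁺` then `c_k² e^{−δ/a_k} → 0` for every `δ > 0`. [folklore] -/
theorem tendsto_sq_mul_exp_neg_of_poly {a c : ℕ → ℝ} (ha0 : ∀ k, 0 < a k) (ha : Tendsto a atTop (𝓝 0))
    {p : ℕ} {K₀ : ℝ} (hK : ∀ k, |c k| ≤ K₀ * (a k)⁻¹ ^ p) {δ : ℝ} (hδ : 0 < δ) :
    Tendsto (fun k => c k ^ 2 * Real.exp (-(δ / a k))) atTop (𝓝 0) := by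
  have hinv : Tendsto (fun k => (a k)⁻¹) atTop atTop :=
    (tendsto_nhdsWithin_iff.2 ⟨ha, Eventually.of_forall fun k => ha0 k⟩).inv_tendsto_nhdsGT_zero
  have hg := ((tendsto_pow_mul_exp_neg_mul hδ (2 * p)).comp hinv).const_mul (K₀ ^ 2)
  rw [mul_zero] at hg
  refine squeeze_zero (fun k => by positivity) (fun k => ?_) hg
  have hc2 : c k ^ 2 ≤ (K₀ * (a k)⁻¹ ^ p) ^ 2 := by
    rw [← sq_abs]
    exact pow_le_pow_left₀ (abs_nonneg _) (hK k) 2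
  have hexp : Real.exp (-(δ / a k)) = Real.exp (-(δ * (a k)⁻¹)) := by rw [div_eq_mul_inv]
  calc c k ^ 2 * Real.exp (-(δ / a k)) ≤ (K₀ * (a k)⁻¹ ^ p) ^ 2 * Real.exp (-(δ / a k)) :=
        mul_le_mul_of_nonneg_right hc2 (Real.exp_pos _).le
    _ = K₀ ^ 2 * (((a k)⁻¹) ^ (2 * p) * Real.exp (-(δ * (a k)⁻¹))) := by
        rw [hexp, mul_pow, ← pow_mul, mul_comm p 2]; ring

/-- **`FiniteCoupling` on the strong-coupling disc for POLYNOMIALLY renormalised schemes** (the physically meaningful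
class: the canonical field-strength renormalisation is `c_k ≍ a_k⁻⁴` up to logarithms): same statement as
`FiniteCouplingStrongSubexp` with the sub-exponential clause replaced by `|c_k| ≤ K₀ a_k^{−p}`. [folklore] -/
theorem FiniteCouplingStrongPoly : open Literature.MathematicalPhysics.QuantumLattice Literature.MathematicalPhysics.AQFT Literature.MathematicalPhysics.QuantumFieldTheory in ∀ (G : Type) [Group G] [TopologicalSpace G] [IsTopologicalGroup G] [CompactSpace G] [MeasurableSpace G] [BorelSpace G], IsCompactSimpleLieGroup G → ∀ (r : LatticeRep G), ∃ β₁ : ℝ, 0 < β₁ ∧ ∀ (sch : SpeciesScheme (YMSpecies G)) (S₁ : SchwingerFamily (EuclideanSpace ℝ (Fin 4))), ((∀ (n : ℕ), n ≠ 0 → ∀ (f : Fin n → SchwartzMap ((EuclideanSpace ℝ (Fin 4))) ℝ) (F : SchwartzMap (Fin n → (EuclideanSpace ℝ (Fin 4))) ℂ), IsTensorOf F (fun i => ofRealTest (f i)) → IsOffDiagonal F → Filter.Tendsto (fun k : ℕ => ((latticeSchwinger r.ρ sch (fun s => s.F) k n (fun _ => r.curvature) f : ℝ) : ℂ)) Filter.atTop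 (nhds (S₁ n F))) ∧ (S₁.toLabelled.IsNormalized ∧ S₁.toLabelled.IsHermitian ∧ S₁.toLabelled.HasLinearGrowth ∧ S₁.toLabelled.IsReflectionPositive ∧ S₁.toLabelled.IsSymmetric ∧ S₁.toLabelled.HasClusterProperty) ∧ (∀ (n : ℕ) (a : (EuclideanSpace ℝ (Fin 4))) (F : SchwartzMap (Fin n → (EuclideanSpace ℝ (Fin 4))) ℂ), IsOffDiagonal F → S₁ n (translateMulti a F) = S₁ n F) ∧ (∀ (R : (EuclideanSpace ℝ (Fin 4)) ≃ₗᵢ[ℝ] (EuclideanSpace ℝ (Fin 4))), LinearMap.det (R.toLinearEquiv : (EuclideanSpace ℝ (Fin 4)) →ₗ[ℝ] (EuclideanSpace ℝ (Fin 4))) = 1 → (∀ i : Fin 4, ∃ j : Fin 4, R (EuclideanSpace.single i 1) = EuclideanSpace.single j 1 ∨ R (EuclideanSpace.single i 1) = -EuclideanSpace.single j 1) → ∀ (n : ℕ) (F : SchwartzMap (Fin n → (EuclideanSpace ℝ (Fin 4))) ℂ), IsOffDiagonal F → S₁ n (linActMulti R F) = S₁ n F) ∧ (∃ Δ : ℝ,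 0 < Δ ∧ S₁.toLabelled.HasMassGap Δ ∧ HasLatticeMassGap r sch Δ)) → (∃ b : ℝ, Filter.Tendsto sch.β Filter.atTop (nhds b) ∧ |b| < β₁) → (∃ (p : ℕ) (K₀ : ℝ), ∀ k : ℕ, |sch.c r.curvature k| ≤ K₀ * (sch.a k)⁻¹ ^ p) → ∃ (K : (EuclideanSpace ℝ (Fin 4)) → ℝ) (C η : ℝ), 0 < η ∧ ContinuousOn K {x : (EuclideanSpace ℝ (Fin 4)) | x ≠ 0} ∧ (∀ x : (EuclideanSpace ℝ (Fin 4)), x ≠ 0 → |K x| ≤ C * (1 + ‖x‖ ^ (η - 10))) ∧ ∀ F : SchwartzMap (Fin 2 → (EuclideanSpace ℝ (Fin 4))) ℂ, IsOffDiagonal F → MeasureTheory.Integrable (fun x : Fin 2 → (EuclideanSpace ℝ (Fin 4)) => (K (x 0 - x 1) : ℂ) * F x) ∧ S₁ 2 F = ∫ x : Fin 2 → (EuclideanSpace ℝ (Fin 4)), (K (x 0 - x 1) : ℂ) * F x := by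
  intro G _ _ _ _ _ _ hG r
  obtain ⟨β₁, hβ₁, h⟩ := FiniteCouplingStrongSubexp G hG r
  refine ⟨β₁, hβ₁, fun sch S₁ hW₁ hb hpoly => h sch S₁ hW₁ hb ?_⟩
  obtain ⟨p, K₀, hK⟩ := hpoly
  exact fun δ hδ => tendsto_sq_mul_exp_neg_of_poly sch.a_pos sch.tendsto_a hK hδ

end Summit.QuantumFields.YangMills.Theorems.CurvatureKernel

end
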